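import Literature.MathematicalPhysics.QuantumFieldTheory.Balaban1983to89.B1Eq353SupNorm

/-!
# `Balaban1983to89.B2Ineq329ZeroAveraging` — [Balaban1982Higgs2] (3.29) p. 590 AT `Ã^η = 0`, the three lattice
inequalities behind it ON THE CONCRETE (Higgs)₂,₃ TORUS CARRIER (`HiggsLattice` / `HiggsAveraging`): the block geometry of
`T_ε ⊃ Bᵏ(y)`, `y ∈ T⁽ᵏ⁾` at level `k ≤ K` under the straight shifts `x ↦ x + tεe_μ`, the AVERAGING INEQUALITY for the plain
block means `Q_k(0)`, JENSEN's inequality for `Q_k(0)`, and the site-to-bond bound — the inputs of the zero-field clause of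
Proposition 3.1 p. 589 proved in the sibling file `B2Prop31ZeroFieldConcrete`

statement-level skeleton of published theorems with citation tags; proofs where landed; nothing here is a claim about the Yang–Mills mass gap

CITATION HEADER.  T. Bałaban, *(Higgs)₂,₃ quantum fields in a finite volume. II. An upper bound*, Commun. Math. Phys. **86**
(1982) 555–594 [Balaban1982Higgs2], Prop. 3.1 and (3.29) pp. 589–590 (PDF held `paper:balaban1982-cmp86-higgs23-ii`; pp.
589–590 [PDF 35–36] READ AS IMAGES on the ×2 renders under `run/shared/lean/pub/pub-balaban/b2b-balaban-ref1/pages/`);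
T. Bałaban, *Regularity and decay of lattice Green's functions*, Commun. Math. Phys. **89** (1983) 571–597
[Balaban1983RegularityDecay], (1.22) p. 574 (*"This theorem implies (3.29) of [2]"*); part I [Balaban1982Higgs1] (1.17)–(1.20)
p. 606–607 (blocks), (2.11) p. 609 (`Q_k(A)`).  Unit `lit-balaban-p15` gen 4, target 3, file 1 (Phase-2 proof seat p15; HOME
`run/shared/lean/pub/lit-balaban/`).  SKELETON rows **B2.Eq3.29** / **B2.Prop3.1** (owner r02; the ℤ^{d+1}-carrier twins are
r14's `B2Prop31ZeroField` and the b04 lineage's `B4Prop31Zero.KeffR_form_ge`, whose elementary mechanism — averaging inequality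
+ Jensen + site-to-bond count — is re-run here on the torus carrier where (3.25) lives; nothing of those files is restated).

WHAT IS PRINTED.  p. 590: *"Now inequality (3.26) of the proposition follows from ⟨φ′_k, Δ⁽ᵏ⁾(Bᵏ(Λ_k), Ã^η)φ′_k⟩ ≥
γ₀(Σ_{⟨x,x′⟩⊂Λ_k}|U(Ã^η(⟨x,x′⟩))φ′_k(x′) − φ′_k(x)|² + Σ_{x∈Λ_k} m²(Lᵏε)²|φ′_k(x)|²) − O((Lᵏε)^{κ₀})|Λ_k|, (3.29) with a
constant γ₀ independent of k, Λ_k"*; p. 589: *"If Ã^ε = 0, then the inequality holds without the last sum on the right side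
and without any restrictions on the configuration Φ."*

WHAT THIS MODULE PROVES (kernel-checked, 0 `sorry`, NO new definition, standard axioms; `k ≤ K` throughout so that the
blocks `Bᵏ(y)` have `L^{kd}` points, `B1Eq353SupNorm.card_blockK`).
 §1 TORUS ARITHMETIC: `sitesPerDir_zero_eq` (`|T_ε|_μ = Lᵏ|T⁽ᵏ⁾|_μ`), `val_blockIter` (`(x_k)_μ = ⌊x_μ/Lᵏ⌋`), the straight
    shifts `shiftN` (`val_shiftN`, `shiftN_add`, `shiftN_injective`), **`blockIter_shiftN_pow`** (`(x + Lᵏεe_μ)_k = x_k + e_μ`),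
    **`blockIter_shiftN_of_le`** (for `t ≤ Lᵏ`, `(x + tεe_μ)_k ∈ {x_k, x_k + e_μ}`), `image_shiftN_blockK`
    (`Bᵏ(y) + Lᵏεe_μ = Bᵏ(y + e_μ)`).
 §2 ZERO FIELD: `avgQk_zero_apply` (`(Q_k(0)f)(y) = L^{−kd}Σ_{x∈Bᵏ(y)} f(x)`).
 §3 JENSEN: `jensen_block` (`(Lᵏε)^d|(Q_k(0)f)(y)|² ≤ Σ_{x∈Bᵏ(y)} ε^d|f(x)|²`), `jensen_sum` (summed over `y ∈ Λ`).
 §4 SITE-TO-BOND: `bondSum_le_siteSum` (`Σ_{⟨y,y′⟩⊂Λ} η^d|∂f|² ≤ 4d·η⁻²·Σ_{y∈Λ} η^d|f(y)|²`).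
 §5 THE AVERAGING INEQUALITY: `sderiv_avgQk_sq_le` (one coarse bond: telescoping along the straight path of `Lᵏ` fine bonds,
    Cauchy–Schwarz, each fine bond met by `≤ Lᵏ` pairs (point of `Bᵏ(y)`, step)), **`averaging_ineq`**
    (`Σ_{⟨y,y′⟩⊂Λ}(Lᵏε)^d|∂^{Lᵏε}Q_k(0)v|² ≤ 2·Σ_{⟨x,x′⟩⊂Bᵏ(Λ)} ε^d|∂^ε v|²`: each fine bond serves at most two coarse bonds).
HONEST SCOPE.  Zero vector field only (plain block means); no constant is optimised.
-/

noncomputable section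

open Finset
open scoped BigOperators InnerProductSpace

namespace Literature.MathematicalPhysics.QuantumFieldTheory.Balaban1983to89.B2Ineq329ZeroAveraging

open Literature.MathematicalPhysics.QuantumFieldTheory.Balaban1983to89.HiggsLattice
open Literature.MathematicalPhysics.QuantumFieldTheory.Balaban1983to89.HiggsAveraging
open Literature.MathematicalPhysics.QuantumFieldTheory.Balaban1983to89.HiggsCovariance
open Literature.MathematicalPhysics.QuantumFieldTheory.Balaban1983to89.HiggsCovariancePos
open Literature.MathematicalPhysics.QuantumFieldTheory.Balaban1983to89.B1Eq214Concrete (val_blockOf)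
open Literature.MathematicalPhysics.QuantumFieldTheory.Balaban1983to89.B1Eq353SupNorm (card_blockK)

variable {P : HiggsLattice.Params} {N : ℕ}

/-! ## §1 Torus arithmetic at level `k ≤ K`: block points of shifted sites -/

section Torus

/-- `|T_ε|_μ = Lᵏ·|T⁽ᵏ⁾|_μ` for `k ≤ K` ((I.1.2)/(I.1.19): `ε⁻¹L_μ = LᴷML′_μ`). [cite: Balaban1982Higgs1, (1.19) p.607] -/
theorem sitesPerDir_zero_eq {k : ℕ} (hk : k ≤ P.K) (μ : Fin P.d) :
    P.sitesPerDir 0 μ = P.L ^ k * P.sitesPerDir k μ := by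
  unfold Params.sitesPerDir
  have h : P.K - 0 = k + (P.K - k) := by omega
  rw [h, pow_add]
  ring

/-- The label of the iterated block point: `(x_k)_μ = ⌊x_μ / Lᵏ⌋` (`k ≤ K`; (I.1.17) corner-anchored blocks, p. 608
*"x ∈ Bʲ(x_j)"*). [cite: Balaban1982Higgs1, (1.20) p.607] -/
theorem val_blockIter : ∀ {k : ℕ}, k ≤ P.K → ∀ (x : HiggsLattice.Site P 0) (μ : Fin P.d),
    ((blockIter k x) μ).val = (x μ).val / P.L ^ k
  | 0, _, x, μ => by
    show (x μ).val = (x μ).val / P.L ^ 0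
    rw [pow_zero, Nat.div_one]
  | k + 1, hk, x, μ => by
    show ((HiggsLattice.blockOf (blockIter k x)) μ).val = (x μ).val / P.L ^ (k + 1)
    rw [val_blockOf (by omega) (blockIter k x) μ, val_blockIter (by omega) x μ, pow_succ, Nat.div_div_eq_div_mul]

/-- The iterated block point as a cast label. [cite: Balaban1982Higgs1, (1.20) p.607] -/
theorem blockIter_apply_eq_cast {k : ℕ} (hk : k ≤ P.K) (x : HiggsLattice.Site P 0) (μ : Fin P.d) :
    (blockIter k x) μ = (((x μ).val / P.L ^ k : ℕ) : ZMod (P.sitesPerDir k μ)) := by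
  rw [← ZMod.natCast_zmod_val ((blockIter k x) μ), val_blockIter hk]

/-- `x + tεe_μ`: the μ-label. [cite: Balaban1982Higgs1, (2.1) p.608] -/
theorem shiftN_apply_self (x : HiggsLattice.Site P 0) (μ : Fin P.d) (t : ℕ) :
    (shiftN x μ t) μ = x μ + t := by
  unfold shiftN
  rw [Function.update_self]

/-- `x + tεe_μ`: the other labels are unchanged. [cite: Balaban1982Higgs1, (2.1) p.608] -/
theorem shiftN_apply_ne (x : HiggsLattice.Site P 0) {μ ν : Fin P.d} (h : ν ≠ μ) (t : ℕ) :
    (shiftN x μ t) ν = x ν := by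
  unfold shiftN
  rw [Function.update_of_ne h]

/-- The μ-label of `x + tεe_μ` as a natural number (periodic). [cite: Balaban1982Higgs1, (2.1) p.608] -/
theorem val_shiftN (x : HiggsLattice.Site P 0) (μ : Fin P.d) (t : ℕ) :
    ((shiftN x μ t) μ).val = ((x μ).val + t) % P.sitesPerDir 0 μ := by
  rw [shiftN_apply_self, ZMod.val_add, ZMod.val_natCast, Nat.add_mod_mod]

/-- `(x + sεe_μ) + tεe_μ = x + (s+t)εe_μ`. [cite: Balaban1982Higgs1, (2.1) p.608] -/
theorem shiftN_add (x : HiggsLattice.Site P 0) (μ : Fin P.d) (s t : ℕ) :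
    shiftN (shiftN x μ s) μ t = shiftN x μ (s + t) := by
  unfold shiftN
  rw [Function.update_self, Function.update_idem, Nat.cast_add, add_assoc]

/-- `x + 0·εe_μ = x`. [cite: Balaban1982Higgs1, (2.1) p.608] -/
theorem shiftN_zero' (x : HiggsLattice.Site P 0) (μ : Fin P.d) : shiftN x μ 0 = x := by
  unfold shiftN
  rw [Nat.cast_zero, add_zero, Function.update_eq_self]

/-- `(x + tεe_μ) + εe_μ = x + (t+1)εe_μ`. [cite: Balaban1982Higgs1, (2.1) p.608] -/
theorem shift_shiftN (x : HiggsLattice.Site P 0) (μ : Fin P.d) (t : ℕ) :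
    (shiftN x μ t).shift μ = shiftN x μ (t + 1) := by
  unfold shiftN Site.shift
  rw [Function.update_self, Function.update_idem, Nat.cast_succ, add_assoc]

/-- Translation by `tεe_μ` is injective on `T_ε`. [cite: Balaban1982Higgs1, (1.2) p.604] -/
theorem shiftN_injective (μ : Fin P.d) (t : ℕ) :
    Function.Injective fun x : HiggsLattice.Site P 0 => shiftN x μ t := by
  intro x x' h
  have h' : shiftN x μ t = shiftN x' μ t := h
  funext ν
  by_cases hν : ν = μ
  · subst hν
    have e := congrFun h' ν
    rw [shiftN_apply_self, shiftN_apply_self] at e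
    exact add_right_cancel e
  · have e := congrFun h' ν
    rwa [shiftN_apply_ne x hν, shiftN_apply_ne x' hν] at e

/-- The μ-label of the block point of `x + tεe_μ`: `⌊(x_μ + t)/Lᵏ⌋` (mod the period of `T⁽ᵏ⁾`). [cite: Balaban1982Higgs1, (1.20) p.607] -/
theorem val_blockIter_shiftN {k : ℕ} (hk : k ≤ P.K) (x : HiggsLattice.Site P 0) (μ : Fin P.d) (t : ℕ) :
    ((blockIter k (shiftN x μ t)) μ).val = (((x μ).val + t) / P.L ^ k) % P.sitesPerDir k μ := by
  rw [val_blockIter hk, val_shiftN]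
  have h := sitesPerDir_zero_eq hk μ
  generalize (x μ).val + t = m
  rw [h, Nat.mod_mul_right_div_self]

/-- The block point of `x + tεe_μ`, μ-component, as a cast label. [cite: Balaban1982Higgs1, (1.20) p.607] -/
theorem blockIter_shiftN_apply_self {k : ℕ} (hk : k ≤ P.K) (x : HiggsLattice.Site P 0) (μ : Fin P.d) (t : ℕ) :
    (blockIter k (shiftN x μ t)) μ = ((((x μ).val + t) / P.L ^ k : ℕ) : ZMod (P.sitesPerDir k μ)) := by
  rw [← ZMod.natCast_zmod_val ((blockIter k (shiftN x μ t)) μ), val_blockIter_shiftN hk, ZMod.natCast_mod]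

/-- The block point of `x + tεe_μ`: the components `ν ≠ μ` are those of `x_k`. [cite: Balaban1982Higgs1, (1.20) p.607] -/
theorem blockIter_shiftN_apply_ne {k : ℕ} (hk : k ≤ P.K) (x : HiggsLattice.Site P 0) {μ ν : Fin P.d} (h : ν ≠ μ)
    (t : ℕ) : (blockIter k (shiftN x μ t)) ν = (blockIter k x) ν := by
  apply ZMod.val_injective
  rw [val_blockIter hk, val_blockIter hk, shiftN_apply_ne x h]

/-- **`(x + Lᵏε e_μ)_k = x_k + Lᵏε e_μ`**: shifting a fine site by one coarse spacing shifts its k-block point by one coarse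
step (periodically on `T⁽ᵏ⁾`). [cite: Balaban1982Higgs1, (1.20) p.607] -/
theorem blockIter_shiftN_pow {k : ℕ} (hk : k ≤ P.K) (x : HiggsLattice.Site P 0) (μ : Fin P.d) :
    blockIter k (shiftN x μ (P.L ^ k)) = (blockIter k x).shift μ := by
  funext ν
  by_cases hν : ν = μ
  · subst hν
    rw [blockIter_shiftN_apply_self hk, Nat.add_div_right _ (pow_pos P.hL k), Nat.cast_add, Nat.cast_one,
      ← blockIter_apply_eq_cast hk]
    show _ = Function.update (blockIter k x) ν ((blockIter k x) ν + 1) ν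
    rw [Function.update_self]
  · rw [blockIter_shiftN_apply_ne hk x hν]
    show _ = Function.update (blockIter k x) μ ((blockIter k x) μ + 1) ν
    rw [Function.update_of_ne hν]

/-- **The straight path stays in two blocks**: for `0 ≤ t ≤ Lᵏ`, the k-block point of `x + tεe_μ` is `x_k` or `x_k + e_μ`.
[cite: Balaban1982Higgs1, (1.20) p.607] -/
theorem blockIter_shiftN_of_le {k : ℕ} (hk : k ≤ P.K) (x : HiggsLattice.Site P 0) (μ : Fin P.d) {t : ℕ}
    (ht : t ≤ P.L ^ k) :
    blockIter k (shiftN x μ t) = blockIter k x ∨ blockIter k (shiftN x μ t) = (blockIter k x).shift μ := by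
  have hn : 0 < P.L ^ k := pow_pos P.hL k
  have hq : ((x μ).val + t) / P.L ^ k = (x μ).val / P.L ^ k
      ∨ ((x μ).val + t) / P.L ^ k = (x μ).val / P.L ^ k + 1 := by
    have h1 : (x μ).val / P.L ^ k ≤ ((x μ).val + t) / P.L ^ k := Nat.div_le_div_right (Nat.le_add_right _ _)
    have h2 : ((x μ).val + t) / P.L ^ k ≤ ((x μ).val + P.L ^ k) / P.L ^ k := Nat.div_le_div_right (by omega)
    rw [Nat.add_div_right _ hn] at h2
    omega
  rcases hq with hq | hq
  · left
    funext ν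
    by_cases hν : ν = μ
    · subst hν
      rw [blockIter_shiftN_apply_self hk, hq, ← blockIter_apply_eq_cast hk]
    · exact blockIter_shiftN_apply_ne hk x hν t
  · right
    funext ν
    by_cases hν : ν = μ
    · subst hν
      rw [blockIter_shiftN_apply_self hk, hq, Nat.cast_add, Nat.cast_one, ← blockIter_apply_eq_cast hk]
      show _ = Function.update (blockIter k x) ν ((blockIter k x) ν + 1) ν
      rw [Function.update_self]
    · rw [blockIter_shiftN_apply_ne hk x hν t]
      show _ = Function.update (blockIter k x) μ ((blockIter k x) μ + 1) ν
      rw [Function.update_of_ne hν]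

/-- `Bᵏ(y) + Lᵏεe_μ ⊂ Bᵏ(y + e_μ)`. [cite: Balaban1982Higgs1, (1.20) p.607] -/
theorem shiftN_pow_mem_blockK {k : ℕ} (hk : k ≤ P.K) {y : HiggsLattice.Site P k} {x : HiggsLattice.Site P 0}
    (hx : x ∈ blockK k y) (μ : Fin P.d) : shiftN x μ (P.L ^ k) ∈ blockK k (y.shift μ) := by
  rw [mem_blockK] at hx ⊢
  rw [blockIter_shiftN_pow hk, hx]

/-- **`Bᵏ(y) + Lᵏεe_μ = Bᵏ(y + e_μ)`** (injective, into, equal cardinalities `L^{kd}`). [cite: Balaban1982Higgs1, (1.20) p.607] -/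
theorem image_shiftN_blockK {k : ℕ} (hk : k ≤ P.K) (y : HiggsLattice.Site P k) (μ : Fin P.d) :
    (blockK k y).image (fun x => shiftN x μ (P.L ^ k)) = blockK k (y.shift μ) := by
  apply Finset.eq_of_subset_of_card_le
  · intro z hz
    obtain ⟨x, hx, rfl⟩ := Finset.mem_image.mp hz
    exact shiftN_pow_mem_blockK hk hx μ
  · rw [Finset.card_image_of_injective _ (shiftN_injective μ _), card_blockK hk, card_blockK hk]

/-- `(Lᵏε)^d = L^{kd}·ε^d` and `Lᵏε = Lᵏ·ε`. [cite: Balaban1982Higgs1, (1.19) p.607] -/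
theorem mesh_pow_d (k : ℕ) : P.mesh k ^ P.d = (P.L : ℝ) ^ (k * P.d) * P.mesh 0 ^ P.d := by
  unfold Params.mesh
  rw [pow_zero, one_mul, mul_pow, ← pow_mul]

/-- `Lᵏε = Lᵏ·ε`. [cite: Balaban1982Higgs1, (1.19) p.607] -/
theorem mesh_eq (k : ℕ) : P.mesh k = (P.L : ℝ) ^ k * P.mesh 0 := by
  unfold Params.mesh
  rw [pow_zero, one_mul]

end Torus

/-! ## §2 Zero vector field: `Q_k(0)` is the plain block mean -/

section Zero

/-- At `A = 0` every contour sum (I.2.3) vanishes. [cite: Balaban1982Higgs1, (2.3) p.608] -/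
theorem multiContourSum_zero_field (k : ℕ) (x : HiggsLattice.Site P 0) :
    multiContourSum (0 : HiggsLattice.VecField P 0) k x = 0 := by
  simp [multiContourSum, contourSum, segSum]

/-- **`(Q_k(0)f)(y) = L^{−kd} Σ_{x∈Bᵏ(y)} f(x)`** (`U(0) = 1`). [cite: Balaban1982Higgs1, (2.11) p.609] -/
theorem avgQk_zero_apply (C : ChargeData N) (k : ℕ) (f : ScalarField P 0 N) (y : HiggsLattice.Site P k) :
    avgQk C (0 : HiggsLattice.VecField P 0) k f y = (((P.L : ℝ) ^ (k * P.d))⁻¹) • ∑ x ∈ blockK k y, f x := by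
  rw [avgQk_apply]
  congr 1
  refine Finset.sum_congr rfl fun x _ => ?_
  rw [multiContourSum_zero_field, ChargeData.U_zero]
  rfl

end Zero

/-! ## §3 Jensen's inequality for the block means -/

section Jensen

/-- **JENSEN**: `(Lᵏε)^d |(Q_k(0)f)(y)|² ≤ Σ_{x∈Bᵏ(y)} ε^d |f(x)|²` (`|Bᵏ(y)| = L^{kd}`, `k ≤ K`).
[folklore] [cite: Balaban1983RegularityDecay, (1.22) p.574] -/
theorem jensen_block (C : ChargeData N) {k : ℕ} (hk : k ≤ P.K) (f : ScalarField P 0 N) (y : HiggsLattice.Site P k) :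
    P.mesh k ^ P.d * ‖avgQk C (0 : HiggsLattice.VecField P 0) k f y‖ ^ 2
      ≤ ∑ x ∈ blockK k y, P.mesh 0 ^ P.d * ‖f x‖ ^ 2 := by
  rw [avgQk_zero_apply, norm_smul, mul_pow, Real.norm_eq_abs, mesh_pow_d]
  set Nn : ℝ := (P.L : ℝ) ^ (k * P.d) with hNn_def
  have hNn : 0 < Nn := pow_pos (by exact_mod_cast P.hL) _
  have hcard : ((blockK k y).card : ℝ) = Nn := by
    rw [card_blockK hk]; push_cast; rfl
  have hm0 : 0 ≤ P.mesh 0 ^ P.d := pow_nonneg (P.mesh_pos 0).le _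
  have h1 : ‖∑ x ∈ blockK k y, f x‖ ^ 2 ≤ Nn * ∑ x ∈ blockK k y, ‖f x‖ ^ 2 := by
    calc ‖∑ x ∈ blockK k y, f x‖ ^ 2 ≤ (∑ x ∈ blockK k y, ‖f x‖) ^ 2 := by
          gcongr
          exact norm_sum_le _ _
      _ ≤ ((blockK k y).card : ℝ) * ∑ x ∈ blockK k y, ‖f x‖ ^ 2 := sq_sum_le_card_mul_sum_sq
      _ = Nn * ∑ x ∈ blockK k y, ‖f x‖ ^ 2 := by rw [hcard]
  rw [abs_of_pos (inv_pos.2 hNn)]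
  calc Nn * P.mesh 0 ^ P.d * (Nn⁻¹ ^ 2 * ‖∑ x ∈ blockK k y, f x‖ ^ 2)
      = (P.mesh 0 ^ P.d * Nn⁻¹) * ‖∑ x ∈ blockK k y, f x‖ ^ 2 := by
        field_simp
    _ ≤ (P.mesh 0 ^ P.d * Nn⁻¹) * (Nn * ∑ x ∈ blockK k y, ‖f x‖ ^ 2) :=
        mul_le_mul_of_nonneg_left h1 (mul_nonneg hm0 (inv_pos.2 hNn).le)
    _ = ∑ x ∈ blockK k y, P.mesh 0 ^ P.d * ‖f x‖ ^ 2 := by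
        rw [Finset.mul_sum, Finset.mul_sum]
        refine Finset.sum_congr rfl fun x _ => ?_
        field_simp

/-- **JENSEN, summed over a region**: `Σ_{y∈Λ}(Lᵏε)^d|(Q_k(0)f)(y)|² ≤ Σ_{x∈Bᵏ(Λ)} ε^d|f(x)|²` (`Bᵏ(Λ)` given as any finite
set `Ω` with `x ∈ Ω ↔ x_k ∈ Λ`). [folklore] [cite: Balaban1983RegularityDecay, (1.22) p.574] -/
theorem jensen_sum (C : ChargeData N) {k : ℕ} (hk : k ≤ P.K) (Λ : Finset (HiggsLattice.Site P k))
    (Ω : Finset (HiggsLattice.Site P 0)) (hΩ : ∀ x, x ∈ Ω ↔ blockIter k x ∈ Λ) (f : ScalarField P 0 N) :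
    ∑ y ∈ Λ, P.mesh k ^ P.d * ‖avgQk C (0 : HiggsLattice.VecField P 0) k f y‖ ^ 2
      ≤ ∑ x ∈ Ω, P.mesh 0 ^ P.d * ‖f x‖ ^ 2 := by
  have hmaps : ∀ x ∈ Ω, blockIter k x ∈ Λ := fun x hx => (hΩ x).1 hx
  rw [← Finset.sum_fiberwise_of_maps_to hmaps]
  refine Finset.sum_le_sum fun y hy => ?_
  have hfib : Ω.filter (fun x => blockIter k x = y) = blockK k y := by
    ext x
    rw [Finset.mem_filter, mem_blockK]
    exact ⟨fun h => h.2, fun h => ⟨(hΩ x).2 (h ▸ hy), h⟩⟩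
  rw [hfib]
  exact jensen_block C hk f y

end Jensen

/-! ## §4 Site-to-bond bound -/

section SiteToBond

/-- `η^d|∂^η f(b)|² = η^d·η⁻²·|f(b₊) − f(b₋)|²` — each summand of the bond form is the printed `η^{d−2}|f(x′) − f(x)|²`.
[cite: Balaban1982Higgs2, Prop. 3.1 (3.26) p.589] -/
theorem bondSummand_eq {k : ℕ} (f : ScalarField P k N) (b : HiggsLattice.PBond P k) :
    P.mesh k ^ P.d * ‖sderiv f b‖ ^ 2 = P.mesh k ^ P.d * (P.mesh k)⁻¹ ^ 2 * ‖f b.tgt - f b.src‖ ^ 2 := by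
  unfold sderiv
  rw [norm_smul, mul_pow, Real.norm_eq_abs, abs_of_pos (inv_pos.2 (P.mesh_pos k))]
  ring

/-- **SITE-TO-BOND**: `Σ_{⟨y,y′⟩⊂Λ} η^d|∂^η f|² ≤ 4d·η⁻²·Σ_{y∈Λ} η^d|f(y)|²` (`|a − b|² ≤ 2|a|² + 2|b|²`; every site is the
initial point of `≤ d` and the final point of `≤ d` bonds). [folklore] [cite: Balaban1983RegularityDecay, (1.22) p.574] -/
theorem bondSum_le_siteSum {k : ℕ} (Λ : Finset (HiggsLattice.Site P k)) (f : ScalarField P k N) :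
    (∑ c : HiggsLattice.PBond P k, if Inside Λ c then P.mesh k ^ P.d * ‖sderiv f c‖ ^ 2 else 0)
      ≤ 4 * P.d * (P.mesh k)⁻¹ ^ 2 * ∑ y ∈ Λ, P.mesh k ^ P.d * ‖f y‖ ^ 2 := by
  classical
  set w : ℝ := P.mesh k ^ P.d * (P.mesh k)⁻¹ ^ 2 with hw
  have hw0 : 0 ≤ w := mul_nonneg (pow_nonneg (P.mesh_pos k).le _) (sq_nonneg _)
  -- pointwise: summand ≤ 2w(|f src|²·[src ∈ Λ] + |f tgt|²·[tgt ∈ Λ])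
  have hpt : ∀ c : HiggsLattice.PBond P k,
      (if Inside Λ c then P.mesh k ^ P.d * ‖sderiv f c‖ ^ 2 else 0)
        ≤ 2 * w * (if c.src ∈ Λ then ‖f c.src‖ ^ 2 else 0) + 2 * w * (if c.tgt ∈ Λ then ‖f c.tgt‖ ^ 2 else 0) := by
    intro c
    by_cases hc : Inside Λ c
    · rw [if_pos hc, if_pos hc.1, if_pos hc.2, bondSummand_eq]
      have h2 : ‖f c.tgt - f c.src‖ ^ 2 ≤ 2 * ‖f c.src‖ ^ 2 + 2 * ‖f c.tgt‖ ^ 2 := by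
        have h := norm_sub_le (f c.tgt) (f c.src)
        have hsq : ‖f c.tgt - f c.src‖ * ‖f c.tgt - f c.src‖ ≤ (‖f c.tgt‖ + ‖f c.src‖) * (‖f c.tgt‖ + ‖f c.src‖) :=
          mul_le_mul h h (norm_nonneg _) (by positivity)
        nlinarith [hsq, sq_nonneg (‖f c.tgt‖ - ‖f c.src‖)]
      calc P.mesh k ^ P.d * (P.mesh k)⁻¹ ^ 2 * ‖f c.tgt - f c.src‖ ^ 2 = w * ‖f c.tgt - f c.src‖ ^ 2 := by rw [hw]
        _ ≤ w * (2 * ‖f c.src‖ ^ 2 + 2 * ‖f c.tgt‖ ^ 2) := mul_le_mul_of_nonneg_left h2 hw0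
        _ = _ := by ring
    · rw [if_neg hc]
      have ha : 0 ≤ (if c.src ∈ Λ then ‖f c.src‖ ^ 2 else 0) := by split_ifs <;> positivity
      have hb : 0 ≤ (if c.tgt ∈ Λ then ‖f c.tgt‖ ^ 2 else 0) := by split_ifs <;> positivity
      positivity
  -- the two site sums
  have hsrc : ∑ c : HiggsLattice.PBond P k, (if c.src ∈ Λ then ‖f c.src‖ ^ 2 else 0)
      = P.d * ∑ y ∈ Λ, ‖f y‖ ^ 2 := by
    rw [← sum_site_dir (fun x (_ : Fin P.d) => if x ∈ Λ then ‖f x‖ ^ 2 else 0)]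
    simp only [Finset.sum_const, Finset.card_univ, Fintype.card_fin, nsmul_eq_mul]
    rw [← Finset.mul_sum, ← Finset.sum_filter, Finset.filter_mem_eq_inter, Finset.univ_inter]
  have htgt : ∑ c : HiggsLattice.PBond P k, (if c.tgt ∈ Λ then ‖f c.tgt‖ ^ 2 else 0)
      = P.d * ∑ y ∈ Λ, ‖f y‖ ^ 2 := by
    show (∑ c : HiggsLattice.PBond P k, (if c.src.shift c.dir ∈ Λ then ‖f (c.src.shift c.dir)‖ ^ 2 else 0)) = _
    rw [← sum_site_dir (fun x (μ : Fin P.d) => if x.shift μ ∈ Λ then ‖f (x.shift μ)‖ ^ 2 else 0)]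
    rw [Finset.sum_comm]
    have hμ : ∀ μ : Fin P.d, ∑ x : HiggsLattice.Site P k, (if x.shift μ ∈ Λ then ‖f (x.shift μ)‖ ^ 2 else 0)
        = ∑ y ∈ Λ, ‖f y‖ ^ 2 := by
      intro μ
      rw [show (∑ x : HiggsLattice.Site P k, (if x.shift μ ∈ Λ then ‖f (x.shift μ)‖ ^ 2 else 0))
          = ∑ x : HiggsLattice.Site P k, (fun y => if y ∈ Λ then ‖f y‖ ^ 2 else 0) (shiftEquiv P k μ x) from rfl,
        Equiv.sum_comp (shiftEquiv P k μ) (fun y => if y ∈ Λ then ‖f y‖ ^ 2 else 0),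
        ← Finset.sum_filter, Finset.filter_mem_eq_inter, Finset.univ_inter]
    simp only [hμ, Finset.sum_const, Finset.card_univ, Fintype.card_fin, nsmul_eq_mul]
  calc (∑ c : HiggsLattice.PBond P k, if Inside Λ c then P.mesh k ^ P.d * ‖sderiv f c‖ ^ 2 else 0)
      ≤ ∑ c : HiggsLattice.PBond P k, (2 * w * (if c.src ∈ Λ then ‖f c.src‖ ^ 2 else 0)
          + 2 * w * (if c.tgt ∈ Λ then ‖f c.tgt‖ ^ 2 else 0)) := Finset.sum_le_sum fun c _ => hpt c
    _ = 2 * w * (P.d * ∑ y ∈ Λ, ‖f y‖ ^ 2) + 2 * w * (P.d * ∑ y ∈ Λ, ‖f y‖ ^ 2) := by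
        rw [Finset.sum_add_distrib, ← Finset.mul_sum, ← Finset.mul_sum, hsrc, htgt]
    _ = 4 * P.d * (P.mesh k)⁻¹ ^ 2 * ∑ y ∈ Λ, P.mesh k ^ P.d * ‖f y‖ ^ 2 := by
        rw [hw, ← Finset.mul_sum]
        ring

end SiteToBond

/-! ## §5 The averaging inequality -/

section Averaging

/-- `(Lᵏ : ℝ)`-bookkeeping: `(L : ℝ)^{kd} = ((Lᵏ : ℕ) : ℝ)^d`. [cite: Balaban1982Higgs1, (1.19) p.607] -/
theorem cast_pow_kd (k : ℕ) : (P.L : ℝ) ^ (k * P.d) = ((P.L ^ k : ℕ) : ℝ) ^ P.d := by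
  push_cast
  rw [pow_mul]

/-- One fine step along the straight path is one fine bond: `v(x + (t+1)εe_μ) − v(x + tεe_μ) = ε·(∂^ε v)(⟨x + tεe_μ, μ⟩)`.
[cite: Balaban1982Higgs1, (1.4) p.604] -/
theorem sub_eq_mesh_smul_sderiv (v : ScalarField P 0 N) (x : HiggsLattice.Site P 0) (μ : Fin P.d) (t : ℕ) :
    v (shiftN x μ (t + 1)) - v (shiftN x μ t) = P.mesh 0 • sderiv v ⟨shiftN x μ t, μ⟩ := by
  unfold sderiv
  rw [smul_smul, mul_inv_cancel₀ (P.mesh_pos 0).ne', one_smul]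
  show _ = v ((shiftN x μ t).shift μ) - v (shiftN x μ t)
  rw [shift_shiftN]

/-- Telescoping along the straight path: `v(x + nεe_μ) − v(x) = Σ_{t<n} (v(x + (t+1)εe_μ) − v(x + tεe_μ))`.
[folklore] [cite: Balaban1982Higgs1, (2.1) p.608] -/
theorem sub_eq_sum_steps (v : ScalarField P 0 N) (x : HiggsLattice.Site P 0) (μ : Fin P.d) (n : ℕ) :
    v (shiftN x μ n) - v x = ∑ t ∈ range n, (v (shiftN x μ (t + 1)) - v (shiftN x μ t)) := by
  induction n with
  | zero => rw [shiftN_zero', sub_self, Finset.sum_range_zero]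
  | succ n ih => rw [Finset.sum_range_succ, ← ih]; abel

/-- **The coarse difference of block means as an average of fine differences** (telescoping along the straight paths):
`(Q_k(0)v)(y + e_μ) − (Q_k(0)v)(y) = L^{−kd} Σ_{x∈Bᵏ(y)} Σ_{t<Lᵏ} ε·(∂^ε v)(⟨x + tεe_μ, μ⟩)`.
[folklore] [cite: Balaban1983RegularityDecay, (1.22) p.574] -/
theorem avgQk_shift_sub {k : ℕ} (hk : k ≤ P.K) (C : ChargeData N) (v : ScalarField P 0 N) (y : HiggsLattice.Site P k)
    (μ : Fin P.d) :
    avgQk C (0 : HiggsLattice.VecField P 0) k v (y.shift μ) - avgQk C (0 : HiggsLattice.VecField P 0) k v y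
      = (((P.L : ℝ) ^ (k * P.d))⁻¹ * P.mesh 0) •
          ∑ p ∈ blockK k y ×ˢ range (P.L ^ k), sderiv v ⟨shiftN p.1 μ p.2, μ⟩ := by
  rw [avgQk_zero_apply, avgQk_zero_apply, ← image_shiftN_blockK hk y μ,
    Finset.sum_image ((shiftN_injective μ (P.L ^ k)).injOn), ← smul_sub, ← Finset.sum_sub_distrib, mul_smul,
    Finset.sum_product, Finset.smul_sum (r := P.mesh 0) (s := blockK k y)]
  congr 1
  refine Finset.sum_congr rfl fun x _ => ?_
  rw [Finset.smul_sum (r := P.mesh 0), sub_eq_sum_steps]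
  exact Finset.sum_congr rfl fun t _ => sub_eq_mesh_smul_sderiv v x μ t

/-- Multiplicity: a fine site is met by at most `Lᵏ` pairs (point of `Bᵏ(y)`, step `t < Lᵏ`) of the straight paths.
[folklore] [cite: Balaban1983RegularityDecay, (1.22) p.574] -/
theorem card_fiber_le {k : ℕ} (y : HiggsLattice.Site P k) (μ : Fin P.d) (z : HiggsLattice.Site P 0) :
    ((blockK k y ×ˢ range (P.L ^ k)).filter (fun p => shiftN p.1 μ p.2 = z)).card ≤ P.L ^ k := by
  classical
  calc ((blockK k y ×ˢ range (P.L ^ k)).filter (fun p => shiftN p.1 μ p.2 = z)).card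
      ≤ (range (P.L ^ k)).card := by
        refine Finset.card_le_card_of_injOn (fun p => p.2) ?_ ?_
        · intro p hp
          rw [Finset.mem_coe, Finset.mem_filter, Finset.mem_product] at hp
          exact Finset.mem_coe.2 hp.1.2
        · intro p hp p' hp' h
          rw [Finset.mem_coe, Finset.mem_filter] at hp hp'
          have h2 : p.2 = p'.2 := h
          have h1 : p.1 = p'.1 := by
            apply shiftN_injective μ p.2
            show shiftN p.1 μ p.2 = shiftN p'.1 μ p.2
            rw [hp.2, ← hp'.2, h2]
          exact Prod.ext h1 h2
    _ = P.L ^ k := Finset.card_range _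

/-- **THE AVERAGING INEQUALITY, one coarse bond** `c = ⟨y, y + e_μ⟩`:
`(Lᵏε)^d |(∂^{Lᵏε}Q_k(0)v)(c)|² ≤ Σ ε^d|(∂^ε v)(b)|²` over the fine bonds `b` of direction `μ` whose endpoints have k-block
points in `{y, y + e_μ}` (telescoping along the `L^{kd}` straight paths of `Lᵏ` steps, Cauchy–Schwarz, each fine bond met by
`≤ Lᵏ` (point, step) pairs). [folklore] [cite: Balaban1983RegularityDecay, (1.22) p.574] -/
theorem sderiv_avgQk_sq_le {k : ℕ} (hk : k ≤ P.K) (C : ChargeData N) (v : ScalarField P 0 N) (y : HiggsLattice.Site P k)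
    (μ : Fin P.d) :
    P.mesh k ^ P.d * ‖sderiv (avgQk C (0 : HiggsLattice.VecField P 0) k v) ⟨y, μ⟩‖ ^ 2
      ≤ ∑ b : HiggsLattice.PBond P 0,
          if b.dir = μ ∧ (blockIter k b.src = y ∨ blockIter k b.src = y.shift μ)
              ∧ (blockIter k b.tgt = y ∨ blockIter k b.tgt = y.shift μ)
          then P.mesh 0 ^ P.d * ‖sderiv v b‖ ^ 2 else 0 := by
  classical
  set n : ℕ := P.L ^ k with hn_def
  set Nn : ℝ := (P.L : ℝ) ^ (k * P.d) with hNn_def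
  set S := blockK k y ×ˢ range n with hS_def
  have hNn : 0 < Nn := pow_pos (by exact_mod_cast P.hL) _
  have hm0 : 0 < P.mesh 0 := P.mesh_pos 0
  have hmk : 0 < P.mesh k := P.mesh_pos k
  have hn0 : (0 : ℝ) < n := by rw [hn_def]; exact_mod_cast pow_pos P.hL k
  have hNn_eq : Nn = (n : ℝ) ^ P.d := by rw [hNn_def, hn_def, cast_pow_kd]
  have hmesh : P.mesh k = n * P.mesh 0 := by rw [mesh_eq, hn_def]; push_cast; rfl
  have hcardS : (S.card : ℝ) = Nn * n := by
    rw [hS_def, Finset.card_product, card_blockK hk, Finset.card_range, hn_def, hNn_def]; push_cast; rfl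
  -- the coarse difference quotient as a multiple of the sum of the fine ones
  have hderiv : sderiv (avgQk C (0 : HiggsLattice.VecField P 0) k v) ⟨y, μ⟩
      = ((P.mesh k)⁻¹ * (Nn⁻¹ * P.mesh 0)) • ∑ p ∈ S, sderiv v ⟨shiftN p.1 μ p.2, μ⟩ := by
    show (P.mesh k)⁻¹ • (avgQk C 0 k v (y.shift μ) - avgQk C 0 k v y) = _
    rw [avgQk_shift_sub hk, smul_smul]
  have hc0 : 0 < (P.mesh k)⁻¹ * (Nn⁻¹ * P.mesh 0) := by positivity
  -- Cauchy–Schwarz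
  have hCS : ‖∑ p ∈ S, sderiv v ⟨shiftN p.1 μ p.2, μ⟩‖ ^ 2
      ≤ (S.card : ℝ) * ∑ p ∈ S, ‖sderiv v ⟨shiftN p.1 μ p.2, μ⟩‖ ^ 2 :=
    calc ‖∑ p ∈ S, sderiv v ⟨shiftN p.1 μ p.2, μ⟩‖ ^ 2 ≤ (∑ p ∈ S, ‖sderiv v ⟨shiftN p.1 μ p.2, μ⟩‖) ^ 2 := by
          gcongr
          exact norm_sum_le _ _
      _ ≤ (S.card : ℝ) * ∑ p ∈ S, ‖sderiv v ⟨shiftN p.1 μ p.2, μ⟩‖ ^ 2 := sq_sum_le_card_mul_sum_sq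
  -- multiplicity
  have hmult : ∑ p ∈ S, ‖sderiv v ⟨shiftN p.1 μ p.2, μ⟩‖ ^ 2
      ≤ n * ∑ z ∈ S.image (fun p => shiftN p.1 μ p.2), ‖sderiv v ⟨z, μ⟩‖ ^ 2 := by
    rw [Finset.sum_comp (fun z => ‖sderiv v (⟨z, μ⟩ : HiggsLattice.PBond P 0)‖ ^ 2)
      (fun p : HiggsLattice.Site P 0 × ℕ => shiftN p.1 μ p.2), Finset.mul_sum]
    refine Finset.sum_le_sum fun z _ => ?_
    rw [nsmul_eq_mul]
    have hc : (((S.filter fun p => shiftN p.1 μ p.2 = z)).card : ℝ) ≤ n := by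
      rw [hn_def]; exact_mod_cast card_fiber_le y μ z
    exact mul_le_mul_of_nonneg_right hc (sq_nonneg _)
  -- the image consists of admissible fine bonds
  have hinj : Set.InjOn (fun z : HiggsLattice.Site P 0 => (⟨z, μ⟩ : HiggsLattice.PBond P 0))
      ↑(S.image (fun p => shiftN p.1 μ p.2)) := by
    intro z _ z' _ h
    cases h
    rfl
  have hre : ∑ z ∈ S.image (fun p => shiftN p.1 μ p.2), P.mesh 0 ^ P.d * ‖sderiv v ⟨z, μ⟩‖ ^ 2
      = ∑ b ∈ (S.image (fun p => shiftN p.1 μ p.2)).image (fun z => (⟨z, μ⟩ : HiggsLattice.PBond P 0)),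
          P.mesh 0 ^ P.d * ‖sderiv v b‖ ^ 2 := by
    rw [Finset.sum_image hinj]
  have himg : ∑ z ∈ S.image (fun p => shiftN p.1 μ p.2), P.mesh 0 ^ P.d * ‖sderiv v ⟨z, μ⟩‖ ^ 2
      ≤ ∑ b : HiggsLattice.PBond P 0,
          if b.dir = μ ∧ (blockIter k b.src = y ∨ blockIter k b.src = y.shift μ)
              ∧ (blockIter k b.tgt = y ∨ blockIter k b.tgt = y.shift μ)
          then P.mesh 0 ^ P.d * ‖sderiv v b‖ ^ 2 else 0 := by
    rw [hre, ← Finset.sum_filter]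
    refine Finset.sum_le_sum_of_subset_of_nonneg (fun b hb => ?_) (fun b _ _ => by positivity)
    rw [Finset.mem_image] at hb
    obtain ⟨z, hz, rfl⟩ := hb
    rw [Finset.mem_image] at hz
    obtain ⟨p, hp, rfl⟩ := hz
    rw [hS_def, Finset.mem_product, mem_blockK, Finset.mem_range] at hp
    rw [Finset.mem_filter]
    refine ⟨Finset.mem_univ _, rfl, ?_, ?_⟩
    · have h := blockIter_shiftN_of_le hk p.1 μ (le_of_lt hp.2)
      rw [hp.1] at h
      exact h
    · have h := blockIter_shiftN_of_le hk p.1 μ (Nat.succ_le_of_lt hp.2)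
      rw [hp.1] at h
      show blockIter k ((shiftN p.1 μ p.2).shift μ) = y ∨ blockIter k ((shiftN p.1 μ p.2).shift μ) = y.shift μ
      rw [shift_shiftN]
      exact h
  -- assemble
  calc P.mesh k ^ P.d * ‖sderiv (avgQk C (0 : HiggsLattice.VecField P 0) k v) ⟨y, μ⟩‖ ^ 2
      = P.mesh k ^ P.d * ((P.mesh k)⁻¹ * (Nn⁻¹ * P.mesh 0)) ^ 2 * ‖∑ p ∈ S, sderiv v ⟨shiftN p.1 μ p.2, μ⟩‖ ^ 2 := by
        rw [hderiv, norm_smul, mul_pow, Real.norm_eq_abs, abs_of_pos hc0, mul_assoc]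
    _ ≤ P.mesh k ^ P.d * ((P.mesh k)⁻¹ * (Nn⁻¹ * P.mesh 0)) ^ 2 * ((S.card : ℝ) * (n * ∑ z ∈ S.image
          (fun p => shiftN p.1 μ p.2), ‖sderiv v ⟨z, μ⟩‖ ^ 2)) := by
        refine mul_le_mul_of_nonneg_left (hCS.trans ?_) (by positivity)
        exact mul_le_mul_of_nonneg_left hmult (Nat.cast_nonneg _)
    _ = ∑ z ∈ S.image (fun p => shiftN p.1 μ p.2), P.mesh 0 ^ P.d * ‖sderiv v ⟨z, μ⟩‖ ^ 2 := by
        rw [hcardS, hmesh, mul_pow, hNn_eq, Finset.mul_sum, Finset.mul_sum, Finset.mul_sum]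
        refine Finset.sum_congr rfl fun z _ => ?_
        field_simp
    _ ≤ _ := himg

/-- Bookkeeping of indicator sums: `[P]·Σ_b [Q b]·G b = Σ_b [P ∧ Q b]·G b`. [folklore] [cite: Balaban1983RegularityDecay, (1.22) p.574] -/
theorem ite_sum_ite {ι : Type*} (s : Finset ι) (p : Prop) [Decidable p] (q : ι → Prop) [DecidablePred q] (G : ι → ℝ) :
    (if p then ∑ b ∈ s, (if q b then G b else 0) else 0) = ∑ b ∈ s, if p ∧ q b then G b else 0 := by
  by_cases hp : p
  · simp [hp]
  · simp [hp]

/-- **Each fine bond serves at most two coarse bonds**: the coarse bonds `c ⊂ Λ` for which a fine bond `b` is admissible (same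
direction `μ`, k-block points of `b₋`, `b₊` in `{c₋, c₊}`) are among `⟨(b₋)_k, μ⟩`, `⟨(b₋)_k − e_μ, μ⟩`; and if there is one,
`b ⊂ Bᵏ(Λ)`. [folklore] [cite: Balaban1983RegularityDecay, (1.22) p.574] -/
theorem coarse_count_le {k : ℕ} (Λ : Finset (HiggsLattice.Site P k)) (Ω : Finset (HiggsLattice.Site P 0))
    (hΩ : ∀ x, x ∈ Ω ↔ blockIter k x ∈ Λ) (b : HiggsLattice.PBond P 0) (G : ℝ) (hG : 0 ≤ G) :
    (∑ c : HiggsLattice.PBond P k,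
        if Inside Λ c ∧ (b.dir = c.dir ∧ (blockIter k b.src = c.src ∨ blockIter k b.src = c.src.shift c.dir)
          ∧ (blockIter k b.tgt = c.src ∨ blockIter k b.tgt = c.src.shift c.dir)) then G else 0)
      ≤ 2 * (if Inside Ω b then G else 0) := by
  classical
  rw [← Finset.sum_filter, Finset.sum_const, nsmul_eq_mul]
  set Sb := (Finset.univ.filter fun c : HiggsLattice.PBond P k =>
    Inside Λ c ∧ (b.dir = c.dir ∧ (blockIter k b.src = c.src ∨ blockIter k b.src = c.src.shift c.dir)
      ∧ (blockIter k b.tgt = c.src ∨ blockIter k b.tgt = c.src.shift c.dir))) with hSb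
  have hsub : Sb ⊆ {⟨blockIter k b.src, b.dir⟩, ⟨(blockIter k b.src).unshift b.dir, b.dir⟩} := by
    intro c hc
    rw [hSb, Finset.mem_filter] at hc
    obtain ⟨_, hdir, hsrc, _⟩ := hc.2
    rw [Finset.mem_insert, Finset.mem_singleton]
    rcases c with ⟨s, d⟩
    simp only at hdir hsrc
    rcases hsrc with h | h
    · left
      rw [h, hdir]
    · right
      rw [h, hdir, unshift_shift]
  have hcard : (Sb.card : ℝ) ≤ 2 := by
    have h := (Finset.card_le_card hsub).trans (Finset.card_insert_le _ _)
    rw [Finset.card_singleton] at h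
    exact_mod_cast h
  by_cases hne : Sb = ∅
  · rw [hne, Finset.card_empty, Nat.cast_zero, zero_mul]
    have : 0 ≤ (if Inside Ω b then G else 0) := by split_ifs <;> simp [hG]
    positivity
  · obtain ⟨c, hc⟩ := Finset.nonempty_iff_ne_empty.2 hne
    rw [hSb, Finset.mem_filter] at hc
    obtain ⟨⟨hs, ht⟩, _, hsrc, htgt⟩ := hc.2
    have hY : ∀ Y, (Y = c.src ∨ Y = c.src.shift c.dir) → Y ∈ Λ := by
      rintro Y (rfl | rfl)
      · exact hs
      · exact ht
    have hin : Inside Ω b := ⟨(hΩ _).2 (hY _ hsrc), (hΩ _).2 (hY _ htgt)⟩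
    rw [if_pos hin]
    exact mul_le_mul_of_nonneg_right hcard hG

/-- **THE AVERAGING INEQUALITY** for a region `Λ ⊂ T⁽ᵏ⁾` and `Ω = Bᵏ(Λ) ⊂ T_ε` (`k ≤ K`, any `v : T_ε → ℝ^N`):
`Σ_{⟨y,y′⟩⊂Λ} (Lᵏε)^d |(∂^{Lᵏε} Q_k(0)v)(⟨y,y′⟩)|² ≤ 2 Σ_{⟨x,x′⟩⊂Bᵏ(Λ)} ε^d |(∂^ε v)(⟨x,x′⟩)|²`, i.e. with the printed weights
`Σ_{⟨y,y′⟩⊂Λ}(Lᵏε)^{d−2}|Q_k(0)v(y′) − Q_k(0)v(y)|² ≤ 2Σ_{⟨x,x′⟩⊂Bᵏ(Λ)}ε^{d−2}|v(x′) − v(x)|²` (each fine bond serves at most the two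
coarse bonds `⟨x_k − e_μ, x_k⟩`, `⟨x_k, x_k + e_μ⟩`). [folklore] [cite: Balaban1983RegularityDecay, (1.22) p.574]
[cite: Balaban1982Higgs2, (3.29) p.590] -/
theorem averaging_ineq {k : ℕ} (hk : k ≤ P.K) (C : ChargeData N) (Λ : Finset (HiggsLattice.Site P k))
    (Ω : Finset (HiggsLattice.Site P 0)) (hΩ : ∀ x, x ∈ Ω ↔ blockIter k x ∈ Λ) (v : ScalarField P 0 N) :
    (∑ c : HiggsLattice.PBond P k, if Inside Λ c then
        P.mesh k ^ P.d * ‖sderiv (avgQk C (0 : HiggsLattice.VecField P 0) k v) c‖ ^ 2 else 0)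
      ≤ 2 * ∑ b : HiggsLattice.PBond P 0, if Inside Ω b then P.mesh 0 ^ P.d * ‖sderiv v b‖ ^ 2 else 0 := by
  classical
  have hG0 : ∀ b : HiggsLattice.PBond P 0, 0 ≤ P.mesh 0 ^ P.d * ‖sderiv v b‖ ^ 2 :=
    fun b => mul_nonneg (pow_nonneg (P.mesh_pos 0).le _) (sq_nonneg _)
  calc (∑ c : HiggsLattice.PBond P k, if Inside Λ c then
          P.mesh k ^ P.d * ‖sderiv (avgQk C (0 : HiggsLattice.VecField P 0) k v) c‖ ^ 2 else 0)
      ≤ ∑ c : HiggsLattice.PBond P k, ∑ b : HiggsLattice.PBond P 0,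
          if Inside Λ c ∧ (b.dir = c.dir ∧ (blockIter k b.src = c.src ∨ blockIter k b.src = c.src.shift c.dir)
            ∧ (blockIter k b.tgt = c.src ∨ blockIter k b.tgt = c.src.shift c.dir))
          then P.mesh 0 ^ P.d * ‖sderiv v b‖ ^ 2 else 0 := by
        refine Finset.sum_le_sum fun c _ => ?_
        rw [← ite_sum_ite]
        split_ifs with hc
        · exact sderiv_avgQk_sq_le hk C v c.src c.dir
        · exact le_rfl
    _ = ∑ b : HiggsLattice.PBond P 0, ∑ c : HiggsLattice.PBond P k,
          if Inside Λ c ∧ (b.dir = c.dir ∧ (blockIter k b.src = c.src ∨ blockIter k b.src = c.src.shift c.dir)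
            ∧ (blockIter k b.tgt = c.src ∨ blockIter k b.tgt = c.src.shift c.dir))
          then P.mesh 0 ^ P.d * ‖sderiv v b‖ ^ 2 else 0 := Finset.sum_comm
    _ ≤ ∑ b : HiggsLattice.PBond P 0, 2 * (if Inside Ω b then P.mesh 0 ^ P.d * ‖sderiv v b‖ ^ 2 else 0) :=
        Finset.sum_le_sum fun b _ => coarse_count_le Λ Ω hΩ b _ (hG0 b)
    _ = 2 * ∑ b : HiggsLattice.PBond P 0, if Inside Ω b then P.mesh 0 ^ P.d * ‖sderiv v b‖ ^ 2 else 0 := by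
        rw [← Finset.mul_sum]

end Averaging

end Literature.MathematicalPhysics.QuantumFieldTheory.Balaban1983to89.B2Ineq329ZeroAveraging
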